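import Literature.MathematicalPhysics.QuantumFieldTheory.Balaban1983to89.B12Lemma4Assembled
import Literature.MathematicalPhysics.QuantumFieldTheory.Balaban1983to89.B12CondIIIJConcreteModels

/-!
# `Balaban1983to89.B12Lemma4ConcreteFrame` — T. Bałaban, *Renormalization group approach to lattice gauge field theories. I*,
Commun. Math. Phys. **109** (1987) 249–301 [Balaban1987RG1], Lemma 4 p. 280: **the schematic statement `B12Sec2to5.Lemma4Printed`
INHABITED ON A CONCRETE FRAME** — the carriers of `B12Sec2to5.Lemma4Frame` (typed there as abstract data, divergence D-b03.1: «the cell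
vocabulary has no type for the spaces of regular complex configurations … nor for the composite map») are now the concrete objects of
`B12RegularSpaces111` / `B12Eq18Current`: `CfgU = CfgUJ` = pairs `(𝐔, 𝐉)` on the lattice, `Uprime a₀ a₁ = U′ᶜ_{k+1}(□₀, a₀, a₁, γ₀′)` = the
union of orbits `B12RegularSpaces111.space` of the frame `F′` of `□₀`, `Ucj α₀ α₁ = U^c_j(X, α₀, α₁)` = `space′` of the frame `F` of `X`,
`comp 𝐔 𝐀 τ B′ = (V, J(V))`, `V = exp iξ(𝐇_j(□₀, τQ(…)) + 𝐀₂(B′))` (the printed configuration after (3.37)/(3.50), `J` = the current (1.8)),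
`analyticOn` = analyticity of `comp` along every analytic family of arguments with values in the printed domain; and for every package `D` of the
by-reference inputs of the proof (the [15]-functions `𝐇_j(□₀, ·)`, `H_{1,j}`, `𝐀₂`, the gauge transformations, the identities (3.38), (3.39)+(3.37),
(3.42), the sizes (3.37), (3.45), (3.50), (J2), (J3), the further restrictions — exactly the hypothesis list of
`B12Lemma4Assembled.ofBackground_mem_space'_lemma4_of_upper_space`, indexed by the printed variables `(𝐔, 𝐀, τ, B′)`),
**`lemma4Printed_frameOf : B12Sec2to5.Lemma4Printed (frameOf D) c`**.

HONEST FRAMING (cell `lit-balaban`, verbatim): statement-level skeleton of published theorems with citation tags; proofs where landed; nothing here is a claim about the Yang–Mills mass gap.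

THE PRINT, verbatim (p. 280 [PDF 32]): *«Lemma 4. For 𝐔 ∈ U′ᶜ_{k+1}(□₀, (1+2β)α₀, (1+2β)α₁), 𝐀 defined on □₀ and satisfying (3.31), B′ defined on
the set of bonds connected with the definition of U_j(□₀, ·) and satisfying |B′| < α₃, we have (U_j(□₀, exp i(τB + B′)), J_j(□₀, exp i(τB +
B′)))|_X ∈ U^c_j(X, α₀, α₁) (3.53) for α₀, α₁, α₂, α₃ sufficiently small and satisfying all the restrictions. The functions in (3.53) are analytic
on the above spaces.»*  PDF held: `paper:balaban1987-cmp109-rg-i-small-field` (journal page = PDF page + 248).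

WHAT THIS MODULE GIVES (definitions with bodies + theorems; no new `Prop`-fact, no sorry; axioms standard):
* `LettersAnalyticAt` — an analytic family of arguments `e ↦ (𝐔(e), 𝐉(e)), 𝐀(e), B′(e)` over a complex normed parameter space (letters analytic);
* `JInputs` — for one value of the printed variables: an orbit representative `Φ₀ = (𝐔, 𝐉′)` satisfying (i)–(iv) of the upper space, the
  functions `𝐇 = 𝐇_j(□₀, Q(…))`, `H₁ = H_{1,j}Q(…)`, `ℓ`, the gauge transformations `u_j, ū_{k+1}, v_j, v, ū_j, w₁` with the printed costs, the
  identities (3.39)+(3.37) / (3.42) / (3.38)×2 and the sizes (3.37), (3.45)×2, (3.50), (J2)×2, (J3) — BY REFERENCE ([15], [14]) as data and hypotheses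
  in their printed shapes (the hypothesis list of `B12Lemma4Assembled.ofBackground_mem_space'_lemma4_of_upper_space`, verbatim);
* `Lemma4Data P i 𝓜 c` — the frames `F` (of `X`, scale `j`) and `F′` (of `□₀`, scale `k+1`), `Y = □̃³`, the projection `π` of (1.8), the total maps
  `𝐊 : (𝐔, 𝐀, τ) ↦ 𝐇_j(□₀, τQ(L⁻¹η𝐇_{k+1}(□₀, (1/i) log V(𝐔))))` and `𝐀₂ : (𝐔, 𝐀, τ, B′) ↦ 𝐀₂`, the set (3.31), `|B′|`, the constant-level
  hypotheses, a `JInputs` package for every value of the variables in the printed domain, and the analyticity of the letters of `𝐊`, `𝐀₂`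
  along analytic families (p. 276 «explicitly given analytic functions of 𝐔», [15]);
* `frameOf D : B12Sec2to5.Lemma4Frame` — the concrete frame; `frameOf_comp`, `mem_Uprime_frameOf_of_satisfies` (API);
* **`lemma4Printed_frameOf`** — `Lemma4Printed (frameOf D) c` (membership by `B12Lemma4Assembled.ofBackground_mem_space'_lemma4_of_upper_space`,
  analyticity by `B12CondIIIJConcreteModels.analyticAt_pair_lemma4`, both BY NAME).
HONEST SCOPE. What is by reference stays by reference: this module PACKAGES the hypotheses of the assembled theorem as the data of a frame, it
does not derive them; in particular the identification of `𝐊`, `𝐀₂`, `𝐇`, … with the objects of [15] ((3.26)–(3.30), (3.37), (3.47)–(3.50)) is the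
content of the package, not of this file.  Carriers live in `Type` (the value algebra `𝔸 : Type`), as `B12Sec2to5.Lemma4Frame` demands.
Unit `lit-balaban-p07` (Phase-2 seat p07 gen 8; TAKING line HOME/STATUS.md 2026-08-21T18:46:03Z; rows B12.Lem4 / B12.Eq3.36 / B12.Eq3.37-3.47,
owners r09/r20), HOME `run/shared/lean/pub/lit-balaban/`.
-/

noncomputable section

open NormedSpace Complex

namespace Literature.MathematicalPhysics.QuantumFieldTheory.Balaban1983to89.B12Lemma4ConcreteFrame

open Literature.MathematicalPhysics.QuantumFieldTheory.Balaban1983to89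
open Literature.MathematicalPhysics.QuantumFieldTheory.Balaban1983to89.B9Eq39Adjoint (R)
open Literature.MathematicalPhysics.QuantumFieldTheory.Balaban1983to89.B12Eq311CurrentExpansion
open Literature.MathematicalPhysics.QuantumFieldTheory.Balaban1983to89.B12RegularSpaces111
open Literature.MathematicalPhysics.QuantumFieldTheory.Balaban1983to89.B12Eq18Current
open Literature.MathematicalPhysics.QuantumFieldTheory.Balaban1983to89.B12CondIIIJConcrete
open Literature.MathematicalPhysics.QuantumFieldTheory.Balaban1983to89.B12Lemma4Assembled
open Literature.MathematicalPhysics.QuantumFieldTheory.Balaban1983to89.B12CondIIIJConcreteModels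

variable {P : Params} {i : ℕ} {𝔸 : Type} [NormedRing 𝔸] [NormedAlgebra ℂ 𝔸] [CompleteSpace 𝔸]

/-! ## §1. Analytic families of the printed variables -/

/-- An analytic family of the printed variables over a complex normed parameter space `E`: `e ↦ ((𝐔(e), 𝐉(e)), 𝐀(e), B′(e))` with every
letter (bond value) analytic at `e₀` — the sense in which «analytic on the above spaces» (Lemma 4) is read on the lattice (as in
`B12CondIIIJConcreteModels.analyticAt_pair_lemma4`, `B12Eq44Analytic`). [cite: Balaban1987RG1, Lemma 4 p.280] -/
def LettersAnalyticAt {E : Type*} [NormedAddCommGroup E] [NormedSpace ℂ E] (Φf : E → FieldPair P i 𝔸ˣ 𝔸)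
    (Af Bf : E → PBond P i → 𝔸) (e₀ : E) : Prop :=
  (∀ b, AnalyticAt ℂ (fun e => ((Φf e).U b : 𝔸)) e₀) ∧ (∀ b, AnalyticAt ℂ (fun e => (Φf e).J b) e₀) ∧
    (∀ b, AnalyticAt ℂ (fun e => Af e b) e₀) ∧ ∀ b, AnalyticAt ℂ (fun e => Bf e b) e₀

/-! ## §2. The by-reference package for one value of the variables -/

/-- **The inputs of the proof of Lemma 4 for one value of `(𝐔, 𝐀, τ, B′)`, by reference** ([15] and pp. 277–280): for the frames `F` (of `X`,
constants `cs`, scale `j`) and `F′` (of `□₀`, constants `cs′`, scale `k+1`), the region `Y = □̃³`, the projection `π`, `η`, `B₃″`, `γ₀′`, the Taylor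
parameter `τ`, `n = |B′|` and the two letters `𝐊 = 𝐇_j(□₀, τQ(…))`, `𝐀 = 𝐀₂` of the configuration `V = exp iξ(𝐊 + 𝐀)`: an orbit representative
`Φ₀ = (𝐔, 𝐉′)` satisfying the four conditions of `U′ᶜ_{k+1}(□₀, (1+2β)α₀, (1+2β)α₁, γ₀′)` ((3.40)); `𝐇 = 𝐇_j(□₀, Q(…))`, `H₁ = H_{1,j}Q(…)`, `ℓ`;
the gauge transformations `u_j, ū_{k+1}, v_j, v` of (3.37)/(3.39)/(3.42) and `ū_j = u_j ∘ ctr`, `w₁` of (3.38) with the printed costs; the identities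
(3.39)+(3.37) (`h339`), (3.42) (`h342`), (3.38) for `V` and for `1` (`h338`, `hJn`, `h338₁`, `hJn₁`); the sizes (3.37) (`hH`, `hHd`, `hK`, `hKd`),
(3.45) at `Q` and `τQ` (`h45`, `h45τ`), (3.50) (`hA`, `hAd`), the second-order inputs (J2)×2 (`hS`, `hSτ`) and (J3) (`hA2`) — the hypothesis list of
`B12Lemma4Assembled.ofBackground_mem_space'_lemma4_of_upper_space`, verbatim. [cite: Balaban1987RG1, (3.37)-(3.52) pp.277-280] -/
structure JInputs (𝓜 : Model 𝔸) (c : B12Sec2to5.Lemma4Consts) (F F' : Frame P i 𝔸) (cs cs' : StepConsts) (Y : Region P i)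
    (π : 𝔸 →ₗ[ℂ] 𝔸) (η B₃'' γ₀' : ℝ) (j : ℕ) (τ n : ℝ) (K A : PBond P i → 𝔸) where
  -- the upper-space datum (3.40)
  Φ₀ : FieldPair P i 𝔸ˣ 𝔸
  hΦ₀ : Satisfies 𝓜 F' cs' ((1 + 2 * c.β) * c.α₀) ((1 + 2 * c.β) * c.α₁) γ₀' Φ₀
  -- the [15]-functions and the gauge transformations
  H : PBond P i → 𝔸
  H₁ : PBond P i → 𝔸
  ℓ : Plaq P i → 𝔸
  uj : Site P i → 𝔸ˣ
  ubar1 : Site P i → 𝔸ˣ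
  vj : Site P i → 𝔸ˣ
  v : Site P i → 𝔸ˣ
  ubar : ℕ → Site P i → 𝔸ˣ
  w₁ : ℕ → Site P i → 𝔸ˣ
  ctr : ℕ → Site P i → Site P i
  hKgc : ∀ b, K b ∈ 𝓜.gc
  hAgc : ∀ b, A b ∈ 𝓜.gc
  -- costs (3.26)/(3.37)
  huj : ∀ y, ‖(uj y : 𝔸)‖ * ‖(↑(uj y)⁻¹ : 𝔸)‖ ≤ Real.exp (c.B₃ ^ 2 * c.O₁ * c.M * c.α₀)
  hubar1 : ∀ y, ‖(ubar1 y : 𝔸)‖ * ‖(↑(ubar1 y)⁻¹ : 𝔸)‖ ≤ Real.exp (c.B₃ * c.O₁ * c.M * c.α₀)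
  hvj : ∀ y, ‖(vj y : 𝔸)‖ * ‖(↑(vj y)⁻¹ : 𝔸)‖ ≤ Real.exp (c.B₃ * c.O₁ * c.M * c.α₀)
  hv : ∀ y, ‖(v y : 𝔸)‖ * ‖(↑(v y)⁻¹ : 𝔸)‖ ≤ Real.exp (c.O₁ * c.M * c.α₁)
  hubar : ∀ n x, ubar n x = uj (ctr n x)
  -- the identities (3.39)+(3.37), (3.42), (3.38)×2
  h339 : ∀ p ∈ F.X.plaqs,
    plaq (fun b => expI cs.ξ (H b)) p = plaq (gaugeU (v * ubar1 * vj * uj)⁻¹ (F'.bg.Un cs'.j Φ₀.U)) p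
  h342 : ∀ b ∈ Y.bonds, current π cs.ξ (fun b => expI cs.ξ (H b)) b =
    ((((v * ubar1 * vj * uj)⁻¹ : Site P i → 𝔸ˣ) b.src : 𝔸ˣ) : 𝔸) *
      ((((c.L ^ (j - 1) * η : ℝ) : ℂ) ^ 3) • F'.bg.Jn cs'.j Φ₀.U b) * ↑((((v * ubar1 * vj * uj)⁻¹ : Site P i → 𝔸ˣ) b.src)⁻¹ : 𝔸ˣ)
  h338 : ∀ m, 1 ≤ m → m ≤ cs.j → ∀ p ∈ F.X₂.plaqs, plaq (F.bg.Un m (fun b => expI cs.ξ (K b + A b))) p =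
    plaq (gaugeU (uj * (ubar m)⁻¹) (fun b => expI cs.ξ (K b + A b))) p
  hJn : ∀ m, 1 ≤ m → m ≤ cs.j → ∀ b ∈ F.X₂.bonds, F.bg.Jn m (fun b => expI cs.ξ (K b + A b)) b =
    current π (cs.L ^ m)⁻¹ (gaugeU (uj * (ubar m)⁻¹) (fun b => expI cs.ξ (K b + A b))) b
  h338₁ : ∀ m, 1 ≤ m → m ≤ cs.j → ∀ p ∈ F.X₂.plaqs,
    plaq (F.bg.Un m (1 : PBond P i → 𝔸ˣ)) p = plaq (gaugeU (w₁ m) (1 : PBond P i → 𝔸ˣ)) p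
  hJn₁ : ∀ m, 1 ≤ m → m ≤ cs.j → ∀ b ∈ F.X₂.bonds,
    F.bg.Jn m (1 : PBond P i → 𝔸ˣ) b = current π (cs.L ^ m)⁻¹ (gaugeU (w₁ m) (1 : PBond P i → 𝔸ˣ)) b
  -- the sizes (3.37), (3.45)×2, (3.50), (J2)×2, (J3)
  hH : ∀ b, ‖H b‖ < c.B₃ ^ 2 * c.O₁ * c.M * c.α₀ * (c.L ^ (j - 1) * η)
  hHd : ∀ μ ν y, ‖grad cs.ξ μ (fun z => H ⟨z, ν⟩) y‖ < c.B₃ ^ 2 * c.O₁ * c.M * c.α₀ * (c.L ^ (j - 1) * η)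
  h45 : ∀ p ∈ F.X.plaqs, ‖(cs.ξ : ℂ)⁻¹ • (H ⟨p.src, p.μ⟩ + H ⟨p.src.shift p.μ, p.ν⟩ - H ⟨p.src.shift p.ν, p.μ⟩ -
    H ⟨p.src, p.ν⟩) - ℓ p‖ < c.B₃ * (c.B₃ * c.O₁ * c.M * c.α₀ * (c.L ^ (j - 1) * η)) ^ 2
  hK : ∀ b, ‖K b‖ < c.B₃ ^ 2 * c.O₁ * c.M * c.α₀ * (c.L ^ (j - 1) * η)
  hKd : ∀ μ ν y, ‖grad cs.ξ μ (fun z => K ⟨z, ν⟩) y‖ < c.B₃ ^ 2 * c.O₁ * c.M * c.α₀ * (c.L ^ (j - 1) * η)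
  h45τ : ∀ p ∈ F.X.plaqs, ‖(cs.ξ : ℂ)⁻¹ • (K ⟨p.src, p.μ⟩ + K ⟨p.src.shift p.μ, p.ν⟩ - K ⟨p.src.shift p.ν, p.μ⟩ -
    K ⟨p.src, p.ν⟩) - (τ : ℂ) • ℓ p‖ < c.B₃ * (c.B₃ * c.O₁ * c.M * c.α₀ * (c.L ^ (j - 1) * η)) ^ 2
  hA : ∀ b, ‖A b‖ ≤ c.B₃ * n
  hAd : ∀ μ ν y, ‖grad cs.ξ μ (fun z => A ⟨z, ν⟩) y‖ ≤ c.B₃ * n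
  hS : ∀ b ∈ Y.bonds, ‖lapCur π cs.ξ (1 : PBond P i → 𝔸ˣ) (H - H₁) b‖ < c.β * c.α₀ * (c.L ^ (j - 1) * η) ^ 2
  hSτ : ∀ b ∈ Y.bonds, ‖lapCur π cs.ξ (1 : PBond P i → 𝔸ˣ) (K - (τ : ℂ) • H₁) b‖ < c.β * c.α₀ * (c.L ^ (j - 1) * η) ^ 2
  hA2 : ∀ b ∈ Y.bonds, ‖lapCur π cs.ξ (1 : PBond P i → 𝔸ˣ) A b‖ ≤ B₃'' * n

/-! ## §3. The data of the concrete frame -/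

/-- **The data of Lemma 4 on the concrete spaces** (pp. 275–280): the frame `F` of `X ⊂ □̃²` at scale `j` (constants `cs`: `0 < ξ ≤ 1`,
`L^jξ = 1`) and the frame `F′` of `□₀ = □̃⁵` at scale `k+1` (`cs′`: `k+1 ≥ 1`, `L^{k+1}ξ′ = 1`, `ξ′ = L⁻¹η`), `Y = □̃³` with the printed
inclusions, the projection `π` of (1.8) with `‖πX‖ ≤ Cπ‖X‖`, `η`, `1 ≤ j`, `L^jη ≤ 1`, `ξ·L^{j−1}η = L⁻¹η`; the set (3.31) of the fields `𝐀`
(`A331`), `|B′|` (`normB`); the total maps `𝐊 : (𝐔, 𝐀, τ) ↦ 𝐇_j(□₀, τQ(L⁻¹η𝐇_{k+1}(□₀, (1/i) log V(𝐔))))` ((3.26)–(3.30), (3.37)) and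
`𝐀₂ : (𝐔, 𝐀, τ, B′) ↦ 𝐀₂` ((3.47)–(3.50)); the further restrictions `B₃ ≥ 1`, `B₃²O(1)M ≥ 1`, `16·O(1)Mα₁ ≤ β`, `1 + 10β ≤ L²`,
`B₃″α₃ ≤ βL⁻²α₀`, `4·C_J·(B₃²O(1)M)²·α₀ ≤ β`; the model data (`exp iξ𝔤ᶜ ⊆ Gᶜ`, `π𝔸 ⊆ 𝔤ᶜ`, `Ad(Gᶜ)𝔤ᶜ ⊆ 𝔤ᶜ`, `π ∘ Ad = Ad ∘ π`); for every value
of the variables in the printed domain a package `JInputs`; and the analyticity of the letters of `𝐊`, `𝐀₂` along analytic families with values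
in the domain (p. 276 «these gauge transformations are explicitly given analytic functions of 𝐔», [15]).
[cite: Balaban1987RG1, Lemma 4 (3.53) p.280 with (3.26)-(3.52) pp.275-280] -/
structure Lemma4Data (P : Params) (i : ℕ) (𝓜 : Model 𝔸) (c : B12Sec2to5.Lemma4Consts) where
  F : Frame P i 𝔸
  cs : StepConsts
  F' : Frame P i 𝔸
  cs' : StepConsts
  Y : Region P i
  π : 𝔸 →ₗ[ℂ] 𝔸
  Cπ : ℝ
  η : ℝ
  j : ℕ
  B₃'' : ℝ
  γ₀' : ℝ
  A331 : Set (PBond P i → 𝔸)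
  normB : (PBond P i → 𝔸) → ℝ
  K : FieldPair P i 𝔸ˣ 𝔸 → (PBond P i → 𝔸) → ℝ → PBond P i → 𝔸
  A₂ : FieldPair P i 𝔸ˣ 𝔸 → (PBond P i → 𝔸) → ℝ → (PBond P i → 𝔸) → PBond P i → 𝔸
  -- further restrictions on the constants
  hB : 1 ≤ c.B₃
  hY : 1 ≤ c.B₃ ^ 2 * c.O₁ * c.M
  hα₁ : 16 * (c.O₁ * c.M * c.α₁) ≤ c.β
  hL10 : 1 + 10 * c.β ≤ c.L ^ 2
  hB'' : 0 ≤ B₃''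
  hres'' : B₃'' * c.α₃ ≤ c.β * c.L⁻¹ ^ 2 * c.α₀
  hresJ : 4 * ((P.d - 1) * (Cπ * C311 1)) * (c.B₃ ^ 2 * c.O₁ * c.M) ^ 2 * c.α₀ ≤ c.β
  -- scales
  hξ : 0 < cs.ξ
  hξ1 : cs.ξ ≤ 1
  hcB : 0 < cs.cB
  hL : 1 ≤ cs.L
  hLξ : cs.L ^ cs.j * cs.ξ = 1
  hη : 0 < η
  hj : 1 ≤ j
  hscale : c.L ^ j * η ≤ 1
  hξx : cs.ξ * (c.L ^ (j - 1) * η) = c.L⁻¹ * η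
  hj' : 1 ≤ cs'.j
  hLξ' : cs'.L ^ cs'.j * cs'.ξ = 1
  hξ' : cs'.ξ = c.L⁻¹ * η
  -- the model and the projection
  heGc : ∀ A ∈ 𝓜.gc, expI cs.ξ A ∈ 𝓜.Gc
  hπ : ∀ X, π X ∈ 𝓜.gc
  hgc : ∀ g ∈ 𝓜.Gc, ∀ X ∈ 𝓜.gc, R g X ∈ 𝓜.gc
  hπR : ∀ (g : 𝔸ˣ) (X : 𝔸), π (R g X) = R g (π X)
  hCπ : 0 ≤ Cπ
  hπn : ∀ X, ‖π X‖ ≤ Cπ * ‖X‖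
  -- geometry
  hXb : F.X.bonds ⊆ Y.bonds
  hXd : F.X.dpairs ⊆ Y.dpairs
  hX₂b : F.X₂.bonds ⊆ Y.bonds
  hX₂p : F.X₂.plaqs ⊆ F.X.plaqs
  hXp' : F.X.plaqs ⊆ F'.X₂.plaqs
  hYb' : Y.bonds ⊆ F'.X₂.bonds
  hXp : ∀ p ∈ F.X.plaqs, (⟨p.src, p.μ⟩ : PBond P i) ∈ Y.bonds ∧ (⟨p.src.shift p.μ, p.ν⟩ : PBond P i) ∈ Y.bonds ∧
    (⟨p.src.shift p.ν, p.μ⟩ : PBond P i) ∈ Y.bonds ∧ (⟨p.src, p.ν⟩ : PBond P i) ∈ Y.bonds ∧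
    (p.src, p.μ, p.ν) ∈ Y.dpairs ∧ (p.src, p.ν, p.μ) ∈ Y.dpairs
  -- the by-reference package on the printed domain
  inputs : ∀ (Φ : FieldPair P i 𝔸ˣ 𝔸) (A : PBond P i → 𝔸) (τ : ℝ) (B' : PBond P i → 𝔸),
    Φ ∈ space 𝓜 F' cs' ((1 + 2 * c.β) * c.α₀) ((1 + 2 * c.β) * c.α₁) γ₀' → A ∈ A331 → 0 ≤ τ → τ ≤ 1 → normB B' < c.α₃ →
      JInputs 𝓜 c F F' cs cs' Y π η B₃'' γ₀' j τ (normB B') (K Φ A τ) (A₂ Φ A τ B')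
  -- analyticity of the letters of `𝐊`, `𝐀₂` along analytic families with values in the domain
  hKan : ∀ {E : Type} [NormedAddCommGroup E] [NormedSpace ℂ E] {Φf : E → FieldPair P i 𝔸ˣ 𝔸} {Af Bf : E → PBond P i → 𝔸}
    {e₀ : E} (τ : ℝ), LettersAnalyticAt Φf Af Bf e₀ →
      Φf e₀ ∈ space 𝓜 F' cs' ((1 + 2 * c.β) * c.α₀) ((1 + 2 * c.β) * c.α₁) γ₀' → Af e₀ ∈ A331 → 0 ≤ τ → τ ≤ 1 →
        normB (Bf e₀) < c.α₃ → ∀ b, AnalyticAt ℂ (fun e => K (Φf e) (Af e) τ b) e₀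
  hA2an : ∀ {E : Type} [NormedAddCommGroup E] [NormedSpace ℂ E] {Φf : E → FieldPair P i 𝔸ˣ 𝔸} {Af Bf : E → PBond P i → 𝔸}
    {e₀ : E} (τ : ℝ), LettersAnalyticAt Φf Af Bf e₀ →
      Φf e₀ ∈ space 𝓜 F' cs' ((1 + 2 * c.β) * c.α₀) ((1 + 2 * c.β) * c.α₁) γ₀' → Af e₀ ∈ A331 → 0 ≤ τ → τ ≤ 1 →
        normB (Bf e₀) < c.α₃ → ∀ b, AnalyticAt ℂ (fun e => A₂ (Φf e) (Af e) τ (Bf e) b) e₀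

/-! ## §4. The concrete frame and Lemma 4 on it -/

variable (𝓜 : Model 𝔸) (c : B12Sec2to5.Lemma4Consts)

/-- **The concrete frame of Lemma 4** over `B12RegularSpaces111`: `CfgU = CfgUJ` = pairs `(𝐔, 𝐉)`, `CfgA = CfgB` = bond functions;
`Uprime a₀ a₁ = U′ᶜ_{k+1}(□₀, a₀, a₁, γ₀′)` (`space` of `F′`), `A331`, `normB` as given, `Ucj α₀ α₁ = U^c_j(X, α₀, α₁)` (`space′` of `F`),
`comp 𝐔 𝐀 τ B′ = (V, J(V))`, `V = exp iξ(𝐊(𝐔, 𝐀, τ) + 𝐀₂(𝐔, 𝐀, τ, B′))` with `J` the current (1.8) (`B12Eq18Current.ofBackground`), and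
`analyticOn a₀ a₁ a₃` = along every analytic family of the variables with `(𝐔, 𝐉)(e₀) ∈ Uprime a₀ a₁`, `𝐀(e₀) ∈ A331`, `|B′(e₀)| < a₃` and every
`τ ∈ [0, 1]`, the pair `e ↦ (V(e), J(V(e)))` (bond values and current) is analytic at `e₀`.
[cite: Balaban1987RG1, Lemma 4 (3.53) p.280; §1 (i)-(iv) pp.261-263] -/
def frameOf (D : Lemma4Data P i 𝓜 c) : B12Sec2to5.Lemma4Frame where
  CfgU := FieldPair P i 𝔸ˣ 𝔸
  CfgA := PBond P i → 𝔸
  CfgB := PBond P i → 𝔸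
  CfgUJ := FieldPair P i 𝔸ˣ 𝔸
  Uprime a₀ a₁ := space 𝓜 D.F' D.cs' a₀ a₁ D.γ₀'
  A331 := D.A331
  normB := D.normB
  Ucj a₀ a₁ := space' 𝓜 D.F D.cs a₀ a₁
  comp Φ A τ B' := ofBackground D.π D.cs.ξ (fun b => expI D.cs.ξ (D.K Φ A τ b + D.A₂ Φ A τ B' b))
  analyticOn a₀ a₁ a₃ := ∀ (E : Type) [NormedAddCommGroup E] [NormedSpace ℂ E] (Φf : E → FieldPair P i 𝔸ˣ 𝔸)
    (Af Bf : E → PBond P i → 𝔸) (τ : ℝ) (e₀ : E), LettersAnalyticAt Φf Af Bf e₀ →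
      Φf e₀ ∈ space 𝓜 D.F' D.cs' a₀ a₁ D.γ₀' → Af e₀ ∈ D.A331 → 0 ≤ τ → τ ≤ 1 → D.normB (Bf e₀) < a₃ →
        AnalyticAt ℂ (fun e : E =>
          ((fun b => ((ofBackground D.π D.cs.ξ
              (fun b => expI D.cs.ξ (D.K (Φf e) (Af e) τ b + D.A₂ (Φf e) (Af e) τ (Bf e) b))).U b : 𝔸)),
            (ofBackground D.π D.cs.ξ (fun b => expI D.cs.ξ (D.K (Φf e) (Af e) τ b + D.A₂ (Φf e) (Af e) τ (Bf e) b))).J)) e₀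

variable {𝓜 c}

/-- The composite map of the concrete frame is the printed pair `(V, J(V))`, `V = exp iξ(𝐊 + 𝐀₂)`. [cite: Balaban1987RG1, (3.53) p.280] -/
theorem frameOf_comp (D : Lemma4Data P i 𝓜 c) (Φ : FieldPair P i 𝔸ˣ 𝔸) (A : PBond P i → 𝔸) (τ : ℝ) (B' : PBond P i → 𝔸) :
    (frameOf 𝓜 c D).comp Φ A τ B' = ofBackground D.π D.cs.ξ (fun b => expI D.cs.ξ (D.K Φ A τ b + D.A₂ Φ A τ B' b)) := rfl

/-- A pair `(𝐔, 𝐉′)` satisfying the four conditions of the upper space lies in `Uprime a₀ a₁ = U′ᶜ_{k+1}(□₀, a₀, a₁, γ₀′)` of the concrete frame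
(its own orbit). [cite: Balaban1987RG1, (1.11)-(1.16) p.262] -/
theorem mem_Uprime_frameOf_of_satisfies (D : Lemma4Data P i 𝓜 c) {a₀ a₁ : ℝ} {Φ : FieldPair P i 𝔸ˣ 𝔸}
    (h : Satisfies 𝓜 D.F' D.cs' a₀ a₁ D.γ₀' Φ) : Φ ∈ (frameOf 𝓜 c D).Uprime a₀ a₁ :=
  mem_space_of_satisfies h

/-- **Lemma 4 (3.53), the printed statement `B12Sec2to5.Lemma4Printed`, on the concrete frame**: for every package `D` of the by-reference
inputs, under «all the restrictions», for `𝐔 ∈ U′ᶜ_{k+1}(□₀, (1+2β)α₀, (1+2β)α₁)`, `𝐀` in (3.31), `τ ∈ [0, 1]`, `|B′| < α₃`: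
`(V, J(V)) ∈ U^c_j(X, α₀, α₁)` (by `B12Lemma4Assembled.ofBackground_mem_space'_lemma4_of_upper_space`) and the functions are analytic on these
spaces (by `B12CondIIIJConcreteModels.analyticAt_pair_lemma4`). [cite: Balaban1987RG1, Lemma 4 (3.53) p.280] -/
theorem lemma4Printed_frameOf [NormOneClass 𝔸] (D : Lemma4Data P i 𝓜 c) : B12Sec2to5.Lemma4Printed (frameOf 𝓜 c D) c := by
  intro hR
  refine ⟨?_, ?_⟩
  · intro Φ A τ B' hΦ hA hτ0 hτ1 hB'
    obtain I := D.inputs Φ A τ B' hΦ hA hτ0 hτ1 hB'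
    exact ofBackground_mem_space'_lemma4_of_upper_space 𝓜 c hR D.hB D.hY D.hα₁ D.hL10 D.hξ D.hξ1 D.hcB D.hL D.hLξ D.hη D.hj
      D.hscale D.hξx hτ0 hτ1 hB' D.hB'' D.hres'' D.hresJ D.heGc D.π D.hπ D.hgc D.hπR D.hCπ D.hπn D.hj' D.hLξ' D.hξ' I.hΦ₀ D.hXb
      D.hXd D.hX₂b D.hX₂p D.hXp' D.hYb' D.hXp I.hKgc I.hAgc I.huj I.hubar1 I.hvj I.hv I.hubar I.h339 I.h342 I.h338 I.hJn I.h338₁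
      I.hJn₁ I.hH I.hHd I.h45 I.hK I.hKd I.h45τ I.hA I.hAd I.hS I.hSτ I.hA2
  · intro E _ _ Φf Af Bf τ e₀ hLe hΦ hA hτ0 hτ1 hB'
    exact analyticAt_pair_lemma4 D.hπn D.cs.ξ (D.hKan τ hLe hΦ hA hτ0 hτ1 hB') (D.hA2an τ hLe hΦ hA hτ0 hτ1 hB')

/-- The membership half of Lemma 4 on the concrete frame, unbundled. [cite: Balaban1987RG1, Lemma 4 (3.53) p.280] -/
theorem comp_mem_Ucj [NormOneClass 𝔸] (D : Lemma4Data P i 𝓜 c) (hR : B12Sec2to5.Lemma4Restrictions c) {Φ : FieldPair P i 𝔸ˣ 𝔸}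
    {A : PBond P i → 𝔸} {τ : ℝ} {B' : PBond P i → 𝔸}
    (hΦ : Φ ∈ space 𝓜 D.F' D.cs' ((1 + 2 * c.β) * c.α₀) ((1 + 2 * c.β) * c.α₁) D.γ₀') (hA : A ∈ D.A331)
    (hτ0 : 0 ≤ τ) (hτ1 : τ ≤ 1) (hB' : D.normB B' < c.α₃) :
    ofBackground D.π D.cs.ξ (fun b => expI D.cs.ξ (D.K Φ A τ b + D.A₂ Φ A τ B' b)) ∈ space' 𝓜 D.F D.cs c.α₀ c.α₁ :=
  ((lemma4Printed_frameOf D) hR).1 Φ A τ B' hΦ hA hτ0 hτ1 hB'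

end Literature.MathematicalPhysics.QuantumFieldTheory.Balaban1983to89.B12Lemma4ConcreteFrame
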